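/-
Copyright (c) 2026 the pub-hodgecm-mathlib formalisation cell (harness21).  Prover seat hodgecm-mathlib-B-p14 (g36): road «S3-tree» (LEAD F0P3a-plan (g11), architect A-p16 (g29),
ruling A-81 (1)(b) «htr₀-ram»), organ «RANK-3 SELF-DUAL TRANSITIVITY, DATUM-FREE (TAME)»; 2026-09-01.  Companion of ★ `UnitaryLatticeTreeSelfDualFrames` (the unramified datum)
and of F0P3a-p07 (g11)'s SPAN-0-ram.
-/
import Literature.NumberTheory.Automorphic.UnitaryLatticeTreeStar   -- ★ T1e V1 (B-p14 (g36)); brings the involution-agnostic T1 cone (Types, Dual, IsTree §26, Apartment §17, TypeTwoGram `formCongr_apply_eq_B₀`)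
import HarnessLib

/-!
# The lattice graph of a hermitian space — EVERY SELF-DUAL VERTEX OF `(K³, J₀)` IS `u·𝒪³` FOR SOME `u ∈ U(σ, J₀)`, for ANY involution `σ` preserving the valuation with `|2| = 1`
# (no unramified datum, no sign condition on `σϖ`: the TAME RAMIFIED case «htr₀-ram» included) (Jacobowitz 1962 §4–§5, §7; O'Meara §82F, §93; Bruhat–Tits 1972 §10)

Topic `NumberTheory/Automorphic`; namespace `Literature.NumberTheory.Automorphic.UnitaryLatticeTree`.  THEOREMS ONLY (no definition, no instance, no notation, no named fact,
no `sorry`); kernel lane.  Cell `pub/hodgecm-mathlib` (D-0151), crux H413 = `stmt-HodgeConjecture-24833`; road «S3-tree», architect A-81 (1)(b): the END-side hypothesis «htr₀-ram»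
(rank-3 self-dual transitivity at a TAME RAMIFIED place) of the tame-ramified SPAN-0 (F0P3a-p07 (g11) ★ `exists_isSelfDualLattice_gt_mapGL_eq_of_charpoly_of_neg`), discharged here
by a DATUM-FREE theorem: the unramified twin ★ `exists_unitary_mapGL_stdLattice_eq_of_isSelfDualLattice_antidiagonal` ∕ ★ `exists_frame_three_of_isSelfDualLattice` needs
`UnramifiedLocalConjDatum σ ϖ` (trace + norm axioms, `σϖ = ϖ`); this file needs only `σ ∘ σ = id`, `|σ ·| = |·|`, `ϖ` a uniformiser and `|2| = 1` (non-dyadic), so it covers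
`σϖ = −ϖ`.

THE MATHEMATICS (`L` a self-dual vertex: `L = latt g`, Gram `G = ᵗσ(g)J₀g ∈ GL₃(𝒪)`, `L = L^♯`; `B₀ = ` the pairing of `J₀ = antidiag(1,1,1)`).
(§1) A PRIMITIVE ISOTROPIC VECTOR `z ∈ L` (`B₀ z z = 0`, `ϖ⁻¹z ∉ L`): `e₀` is isotropic; `ϖ^kL₀ ≤ L ≤ ϖ^{−k}L₀` (★ §26, ★ (D3)–(D4)), so `n ↦ ϖⁿ·ϖ^{−(k+1)}e₀` enters `L` at a least
`n ≥ 1` (`Nat.find`).  (§2) A UNIMODULAR PARTNER: `ϖ⁻¹z ∉ L = L^♯` gives `y ∈ L` with `|B₀ y (ϖ⁻¹z)| > 1`, i.e. `|B₀ z y| = 1`; rescale to `B₀ z y = 1`.  (§3) A HYPERBOLIC PAIR: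
`y′ = y − ½B₀(y,y)·z ∈ L` is isotropic with `B₀ z y′ = 1` (`B₀ y y ∈ 𝒪` is `σ`-fixed, `|2| = 1`).  (§4) UNIMODULAR COMPLETION: in coordinates `z = gc`, `y′ = gd` (`c, d ∈ 𝒪³`, `c`
primitive) some `2 × 2` minor `m_j` of `(c | d)` is a UNIT — else `d ≡ μc (mod 𝔪)`, `y′ − μz ∈ ϖL`, and `1 = B₀ z y′ = B₀(z, y′ − μz) ∈ ϖ𝒪` — so `(z | g_j | y′) = g·(c | e_j | d)` spans `L`;
clear the middle column: `x = g_j − B₀(y′,g_j)z − B₀(z,g_j)y′ ⊥ z, y′`, basis `(z | x | y′)` of `L` with Gram `[[0,0,1],[0,ε,0],[1,0,0]]`.  (§5) DETERMINANT CLASS: `−ε = det Gram =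
det J₀ · σ(det)·det = −N(a)` (★ `det_gram_three`), `a = det (z|x|y′)` a unit, so `x ↦ a⁻¹x` gives Gram EXACTLY `J₀`: the matrix `u = (z | a⁻¹x | y′)` lies in `U(σ, J₀)` and `u·𝒪³ = L` ∎.

* §1 **`exists_isotropic_mem_not_mem`**.  §2 **`exists_mem_B₀_eq_one`**.  §3 **`exists_hyperbolic_pair`**.
* §4 `v_B₀_le_one_of_isSelfDualLattice`, `v_mul_sub_mul_lt_one_of_minors`, **`exists_v_det_completion_eq_one`** (a UNIT `2 × 2` minor of the coordinates of a primitive hyperbolic pair: `(z | g_j | y)` completes to a basis of `L`).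
* §5 **`exists_unitary_mapGL_stdLattice_eq_of_isSelfDualLattice_of_v_two`** — THE HEAD («htr₀-ram», datum-free); vertex form `exists_latticeGraphIso_root_eq_of_v_two`.

HONEST LABEL: HC_CM is proved only modulo the 2 remaining named inputs (hLiu418 24832, h413 24833) until rung 0 closes; nothing printed is asserted here (elementary lattice
algebra over a valuation ring); S3 (`stub_N6nsS3id`) stays a print row until the road's END lands.

## References
* [Jacobowitz1962] R. Jacobowitz, *Hermitian forms over local fields*, Amer. J. Math. 84 (1962), §4–§5 (hyperbolic planes split; unimodular lattices), §7–§8 (the ramified non-dyadic classification: rank + discriminant).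
* [Omeara1963] O. T. O'Meara, *Introduction to Quadratic Forms* (1963), §82F (primitive vectors of a unimodular lattice pair to `1`), §93 (hyperbolic splitting off).
* [BruhatTits1972] F. Bruhat, J. Tits, *Groupes réductifs sur un corps local I*, Publ. Math. IHÉS 41 (1972), §10 (the group is transitive on the hyperspecial ∕ special vertices of one type).
* [Tits1979] J. Tits, *Reductive groups over local fields*, PSPM 33.1 (1979), §2.4, §3.3.3.
-/

set_option autoImplicit false

noncomputable section

open scoped Valued WithZero Matrix MatrixGroups

namespace Literature.NumberTheory.Automorphic.UnitaryLatticeTree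

open Literature.NumberTheory.Automorphic Literature.NumberTheory.Automorphic.HermitianLattice
open Literature.NumberTheory.Automorphic.CartanUnique

variable {K : Type*} [Field K] [Valued K ℤᵐ⁰] {σ : K →+* K} {ϖ : K}

/-! ## §1 A primitive isotropic vector in every vertex lattice -/

/-- **Every vertex lattice `L` of `(K³, J₀)` contains a PRIMITIVE ISOTROPIC vector**: `z ∈ L` with `B₀ z z = 0` and `ϖ⁻¹z ∉ L` — a suitable `ϖ`-power multiple of the isotropic `e₀`
(`ϖ^kL₀ ≤ L ≤ ϖ^{−k}L₀`; the least power entering `L`). [cite: Omeara1963, §82F] [cite: BruhatTits1972, §10] -/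
theorem exists_isotropic_mem_not_mem (hvσ : ∀ a, Valued.v (σ a) = Valued.v a) (hϖ : Valued.v ϖ = WithZero.exp (-1 : ℤ)) {d : ℕ}
    {L : Submodule 𝒪[K] (Fin 3 → K)} (hL : IsVertexLattice σ ϖ ((StdForm.antidiagonal 3).over K) d L) :
    ∃ z ∈ L, B₀ σ 3 z z = 0 ∧ ϖ⁻¹ • z ∉ L := by
  classical
  have hϖ0 : ϖ ≠ 0 := uniformizer_ne_zero hϖ
  obtain ⟨k, hk⟩ := exists_scaleLattice_pow_stdLattice_le_of_isVertexLattice hϖ hL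
  have hup : L ≤ scaleLattice (ϖ ^ k)⁻¹ (stdLattice K 3) :=
    le_scaleLattice_of_isVertexLattice hvσ hϖ0 isUnit_det_antidiagonal isIntMatrix_antidiagonal isIntMatrix_antidiagonal_inv hL hk
  -- the family `x n = (ϖⁿ ∕ ϖ^{k+1}) • e₀`
  let x : ℕ → (Fin 3 → K) := fun n => (ϖ ^ n / ϖ ^ (k + 1)) • (Pi.single 0 1 : Fin 3 → K)
  have hx : ∀ n, x n = (ϖ ^ n / ϖ ^ (k + 1)) • (Pi.single 0 1 : Fin 3 → K) := fun _ => rfl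
  have hx0 : x 0 ∉ L := by
    intro h
    have h' := (mem_scaleLattice_stdLattice_iff (inv_ne_zero (pow_ne_zero k hϖ0)) _).1 (hup h) 0
    rw [hx, pow_zero, Pi.smul_apply, Pi.single_eq_same, smul_eq_mul, mul_one, one_div, map_inv₀, map_inv₀, v_uniformizer_pow hϖ, v_uniformizer_pow hϖ,
      ← WithZero.exp_neg, ← WithZero.exp_neg, WithZero.exp_le_exp] at h'
    push_cast at h'
    omega
  have hxN : x (2 * k + 1) ∈ L := by
    refine hk ((mem_scaleLattice_iff (pow_ne_zero k hϖ0) _ _).2 ?_)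
    have h1 : (ϖ ^ k)⁻¹ • x (2 * k + 1) = Pi.single 0 1 := by
      rw [hx, smul_smul, show (ϖ ^ k)⁻¹ * (ϖ ^ (2 * k + 1) / ϖ ^ (k + 1)) = 1 by field_simp; ring, one_smul]
    rw [h1]
    exact single_mem_stdLattice 0
  have hex : ∃ n, x n ∈ L := ⟨_, hxN⟩
  have hn₀mem : x (Nat.find hex) ∈ L := Nat.find_spec hex
  have hn₀pos : 0 < Nat.find hex := by
    rw [Nat.pos_iff_ne_zero]
    intro h0
    rw [h0] at hn₀mem
    exact hx0 hn₀mem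
  refine ⟨x (Nat.find hex), hn₀mem, ?_, ?_⟩
  · rw [hx]
    exact B₀_smul_smul_self_eq_zero (by rw [B₀_single_left]; simp [Fin.rev]) _
  · have heq : ϖ⁻¹ • x (Nat.find hex) = x (Nat.find hex - 1) := by
      obtain ⟨m, hm⟩ := Nat.exists_eq_add_of_le' hn₀pos
      rw [hx, hx, hm, Nat.add_sub_cancel, smul_smul]
      congr 1
      rw [pow_succ]
      field_simp
    rw [heq]
    exact Nat.find_min hex (Nat.sub_lt hn₀pos one_pos)

/-! ## §2 A unimodular partner of a primitive vector in a self-dual lattice -/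

/-- **A PRIMITIVE VECTOR OF A SELF-DUAL LATTICE PAIRS TO `1`**: if `L = L^♯`, `z ∈ L` and `ϖ⁻¹z ∉ L`, there is `y ∈ L` with `B₀ z y = 1` (`ϖ⁻¹z ∉ L^♯` produces `y ∈ L` with
`|B₀ y (ϖ⁻¹z)| > 1`, i.e. `|B₀ z y| = 1`; rescale by the unit `(B₀ z y)⁻¹`). [cite: Omeara1963, §82F] [cite: Jacobowitz1962, §4] -/
theorem exists_mem_B₀_eq_one (hσ : ∀ a, σ (σ a) = a) (hvσ : ∀ a, Valued.v (σ a) = Valued.v a) (hϖ : Valued.v ϖ = WithZero.exp (-1 : ℤ))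
    {L : Submodule 𝒪[K] (Fin 3 → K)} (hL : IsSelfDualLattice σ ϖ ((StdForm.antidiagonal 3).over K) L) {z : Fin 3 → K} (hz : z ∈ L) (hzp : ϖ⁻¹ • z ∉ L) :
    ∃ y ∈ L, B₀ σ 3 z y = 1 := by
  have hϖ0 : ϖ ≠ 0 := uniformizer_ne_zero hϖ
  have hLd : dualLatt σ ((StdForm.antidiagonal 3).over K) L = L := dualLatt_eq_self_of_isSelfDualLattice hvσ isUnit_det_antidiagonal hL
  -- `ϖ⁻¹z ∉ L^♯`: some `y ∈ L` with `|B₀ y (ϖ⁻¹z)| > 1`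
  have h1 : ¬ ∀ y ∈ L, Valued.v (pairing σ ((StdForm.antidiagonal 3).over K) y (ϖ⁻¹ • z)) ≤ 1 := fun h => hzp (by rw [← hLd]; exact h)
  push Not at h1
  obtain ⟨y, hy, hlt⟩ := h1
  rw [pairing_antidiagonal, form_smul_right, map_mul, map_inv₀] at hlt
  -- `|B₀ y z| = 1`
  have hle : Valued.v (B₀ σ 3 y z) ≤ 1 := by
    have := (mem_dualLatt σ _ L z).1 (by rw [hLd]; exact hz) y hy
    rwa [pairing_antidiagonal] at this
  have hone : Valued.v (B₀ σ 3 y z) = 1 := by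
    by_contra hne
    have hlt1 : Valued.v (B₀ σ 3 y z) < 1 := lt_of_le_of_ne hle hne
    have hle' : Valued.v (B₀ σ 3 y z) ≤ Valued.v ϖ := by rw [hϖ]; exact (v_lt_one_iff _).1 hlt1
    have : (Valued.v ϖ)⁻¹ * Valued.v (B₀ σ 3 y z) ≤ 1 := by
      calc (Valued.v ϖ)⁻¹ * Valued.v (B₀ σ 3 y z) ≤ (Valued.v ϖ)⁻¹ * Valued.v ϖ := mul_le_mul_right hle' _
        _ = 1 := inv_mul_cancel₀ ((Valuation.ne_zero_iff _).2 hϖ0)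
    exact not_lt.2 this hlt
  -- `B₀ z y = σ (B₀ y z)` is a unit too; rescale `y`
  have hzy : Valued.v (B₀ σ 3 z y) = 1 := by rw [← isHermitianForm_B₀ hσ y z, hvσ, hone]
  have hzy0 : B₀ σ 3 z y ≠ 0 := fun h => by rw [h, map_zero] at hzy; exact zero_ne_one hzy
  have hinv : Valued.v (B₀ σ 3 z y)⁻¹ ≤ 1 := by rw [map_inv₀, hzy, inv_one]
  refine ⟨(⟨(B₀ σ 3 z y)⁻¹, hinv⟩ : 𝒪[K]) • y, L.smul_mem _ hy, ?_⟩
  rw [form_smul_right_int]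
  exact inv_mul_cancel₀ hzy0

/-! ## §3 A unimodular hyperbolic pair in a self-dual lattice (`|2| = 1`) -/

/-- **A SELF-DUAL VERTEX CONTAINS A UNIMODULAR HYPERBOLIC PAIR** (`σ` an involution preserving `v`, `ϖ` a uniformiser, `|2| = 1`): `z, y ∈ L` with `B₀ z z = 0`, `B₀ y y = 0`,
`B₀ z y = 1` and `z` primitive (`ϖ⁻¹z ∉ L`) — from §1–§2 by `y ↦ y − ½B₀(y,y)·z`. [cite: Jacobowitz1962, §4–§5] [cite: Omeara1963, §93] -/
theorem exists_hyperbolic_pair (hσ : ∀ a, σ (σ a) = a) (hvσ : ∀ a, Valued.v (σ a) = Valued.v a) (hϖ : Valued.v ϖ = WithZero.exp (-1 : ℤ)) (h2 : Valued.v (2 : K) = 1)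
    {L : Submodule 𝒪[K] (Fin 3 → K)} (hL : IsSelfDualLattice σ ϖ ((StdForm.antidiagonal 3).over K) L) :
    ∃ z ∈ L, ∃ y ∈ L, B₀ σ 3 z z = 0 ∧ B₀ σ 3 y y = 0 ∧ B₀ σ 3 z y = 1 ∧ ϖ⁻¹ • z ∉ L := by
  obtain ⟨z, hz, hzz, hzp⟩ := exists_isotropic_mem_not_mem hvσ hϖ hL
  obtain ⟨y, hy, hzy⟩ := exists_mem_B₀_eq_one hσ hvσ hϖ hL hz hzp
  have h20 : (2 : K) ≠ 0 := fun h => by rw [h, map_zero] at h2; exact zero_ne_one h2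
  -- `t = ½ B₀ y y ∈ 𝒪`, `σ t = t`
  have hyy : Valued.v (B₀ σ 3 y y) ≤ 1 := by
    have := (mem_dualLatt σ _ L y).1 (by rw [dualLatt_eq_self_of_isSelfDualLattice hvσ isUnit_det_antidiagonal hL]; exact hy) y hy
    rwa [pairing_antidiagonal] at this
  have ht : Valued.v (B₀ σ 3 y y / 2) ≤ 1 := by rw [map_div₀, h2, div_one]; exact hyy
  have hσt : σ (B₀ σ 3 y y / 2) = B₀ σ 3 y y / 2 := by rw [map_div₀, isHermitianForm_B₀ hσ y y, map_ofNat]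
  have hyz : B₀ σ 3 y z = 1 := by rw [← isHermitianForm_B₀ hσ z y, hzy, map_one]
  refine ⟨z, hz, y - (⟨B₀ σ 3 y y / 2, ht⟩ : 𝒪[K]) • z, L.sub_mem hy (L.smul_mem _ hz), hzz, ?_, ?_, hzp⟩
  · -- `B₀ (y − t z) (y − t z) = B₀ y y − t − σ t = 0`
    have e : ((⟨B₀ σ 3 y y / 2, ht⟩ : 𝒪[K]) • z : Fin 3 → K) = (B₀ σ 3 y y / 2) • z := rfl
    rw [e]
    simp only [map_sub, LinearMap.sub_apply, form_smul_left, form_smul_right, hzz, hzy, hyz, hσt]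
    field_simp
    ring
  · have e : ((⟨B₀ σ 3 y y / 2, ht⟩ : 𝒪[K]) • z : Fin 3 → K) = (B₀ σ 3 y y / 2) • z := rfl
    rw [e, map_sub, form_smul_right, hzy, hzz, mul_zero, sub_zero]

/-! ## §4 Unimodular completion of a primitive hyperbolic pair -/

/-- Integrality of the pairing on a self-dual lattice: `|B₀ x w| ≤ 1` for `x, w ∈ L = L^♯`. [cite: Jacobowitz1962, §4] -/
theorem v_B₀_le_one_of_isSelfDualLattice (hσ : ∀ a, σ (σ a) = a) (hvσ : ∀ a, Valued.v (σ a) = Valued.v a)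
    {L : Submodule 𝒪[K] (Fin 3 → K)} (hL : IsSelfDualLattice σ ϖ ((StdForm.antidiagonal 3).over K) L) {x w : Fin 3 → K} (hx : x ∈ L) (hw : w ∈ L) :
    Valued.v (B₀ σ 3 x w) ≤ 1 := by
  have h := (mem_dualLatt σ _ L x).1 (by rw [dualLatt_eq_self_of_isSelfDualLattice hvσ isUnit_det_antidiagonal hL]; exact hx) w hw
  rw [pairing_antidiagonal] at h
  rw [← isHermitianForm_B₀ hσ w x, hvσ]
  exact h

/-- From the three `2 × 2` minors to all antisymmetric coordinate products (bookkeeping in `Fin 3`). [cite: Omeara1963, §82F] -/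
theorem v_mul_sub_mul_lt_one_of_minors {c d : Fin 3 → K} (h0 : Valued.v (c 2 * d 1 - c 1 * d 2) < 1) (h1 : Valued.v (c 0 * d 2 - c 2 * d 0) < 1)
    (h2 : Valued.v (c 1 * d 0 - c 0 * d 1) < 1) : ∀ i l : Fin 3, Valued.v (c i * d l - c l * d i) < 1 := by
  intro i l
  fin_cases i <;> fin_cases l
  · simp
  · simpa using (show Valued.v (-(c 1 * d 0 - c 0 * d 1)) < 1 by rw [Valuation.map_neg]; exact h2)
  · simpa using h1
  · simpa using h2
  · simp
  · simpa using (show Valued.v (-(c 2 * d 1 - c 1 * d 2)) < 1 by rw [Valuation.map_neg]; exact h0)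
  · simpa using (show Valued.v (-(c 0 * d 2 - c 2 * d 0)) < 1 by rw [Valuation.map_neg]; exact h1)
  · simpa using h0
  · simp

/-- **A UNIT MINOR**: for a self-dual `L = latt g` and a hyperbolic pair `z = gc`, `y = gd` in `L` with `z` primitive (`ϖ⁻¹z ∉ L`), one of the three `2 × 2` minors of the integral
coordinate matrix `(c | d)` is a UNIT — otherwise `d ≡ μc (mod 𝔪)` for a unit coordinate `c_i` and `μ = d_i∕c_i`, so `y − μz ∈ ϖL` and `1 = B₀ z y = B₀ z (y − μz) ∈ ϖ𝒪`.  Stated as: some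
`det (c | e_j | d)` is a unit. [cite: Omeara1963, §82F] [cite: Jacobowitz1962, §4–§5] -/
theorem exists_v_det_completion_eq_one (hσ : ∀ a, σ (σ a) = a) (hvσ : ∀ a, Valued.v (σ a) = Valued.v a) (hϖ : Valued.v ϖ = WithZero.exp (-1 : ℤ))
    (g : GL (Fin 3) K) (hL : IsSelfDualLattice σ ϖ ((StdForm.antidiagonal 3).over K) (latt (g : Matrix (Fin 3) (Fin 3) K)))
    {z y : Fin 3 → K} (hz : z ∈ latt (g : Matrix (Fin 3) (Fin 3) K)) (hy : y ∈ latt (g : Matrix (Fin 3) (Fin 3) K))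
    (hzz : B₀ σ 3 z z = 0) (hzy : B₀ σ 3 z y = 1) (hzp : ϖ⁻¹ • z ∉ latt (g : Matrix (Fin 3) (Fin 3) K)) :
    ∃ j : Fin 3, Valued.v (Matrix.of ![(g : Matrix (Fin 3) (Fin 3) K)⁻¹.mulVec z, Pi.single j 1, (g : Matrix (Fin 3) (Fin 3) K)⁻¹.mulVec y]).det = 1 := by
  have hϖ0 : ϖ ≠ 0 := uniformizer_ne_zero hϖ
  have hvϖ1 : Valued.v ϖ < 1 := by rw [hϖ, ← WithZero.exp_zero]; exact WithZero.exp_lt_exp.2 (by norm_num)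
  have hlt1 : ∀ t : K, Valued.v t < 1 ↔ Valued.v t ≤ Valued.v ϖ := fun t => by rw [hϖ]; exact v_lt_one_iff t
  have hg : IsUnit (g : Matrix (Fin 3) (Fin 3) K).det := Matrix.isUnits_det_units g
  set c : Fin 3 → K := (g : Matrix (Fin 3) (Fin 3) K)⁻¹.mulVec z with hcdef
  set d : Fin 3 → K := (g : Matrix (Fin 3) (Fin 3) K)⁻¹.mulVec y with hddef
  have hc : c ∈ stdLattice K 3 := (mem_latt_iff_of_isUnit hg z).1 hz
  have hd : d ∈ stdLattice K 3 := (mem_latt_iff_of_isUnit hg y).1 hy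
  have hgc : (g : Matrix (Fin 3) (Fin 3) K).mulVec c = z := by rw [hcdef, Matrix.mulVec_mulVec, Matrix.mul_nonsing_inv _ hg, Matrix.one_mulVec]
  have hgd : (g : Matrix (Fin 3) (Fin 3) K).mulVec d = y := by rw [hddef, Matrix.mulVec_mulVec, Matrix.mul_nonsing_inv _ hg, Matrix.one_mulVec]
  -- the three completions are integral
  have hint : ∀ j : Fin 3, Valued.v (Matrix.of ![c, Pi.single j 1, d]).det ≤ 1 := by
    intro j
    refine v_det_le_one_of_forall_v_le_one fun i l => ?_
    fin_cases i
    · simpa using hc l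
    · simp only [Fin.mk_one, Matrix.of_apply, Matrix.cons_val_one, Matrix.cons_val_zero, Pi.single_apply]
      split_ifs <;> simp
    · simpa using hd l
  by_contra hne
  push Not at hne
  have hlt : ∀ j : Fin 3, Valued.v (Matrix.of ![c, Pi.single j 1, d]).det < 1 := fun j => lt_of_le_of_ne (hint j) (hne j)
  -- the three minors
  have h0 := hlt 0
  have h1 := hlt 1
  have h2 := hlt 2
  rw [Matrix.det_fin_three] at h0 h1 h2
  simp [Matrix.of_apply] at h0 h1 h2
  have h0' : Valued.v (c 2 * d 1 - c 1 * d 2) < 1 := by convert h0 using 2; ring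
  have h1' : Valued.v (c 0 * d 2 - c 2 * d 0) < 1 := h1
  have h2' : Valued.v (c 1 * d 0 - c 0 * d 1) < 1 := by convert h2 using 2; ring
  have hsmall := v_mul_sub_mul_lt_one_of_minors h0' h1' h2'
  -- a unit coordinate of `c` (`z` is primitive)
  obtain ⟨i, hi⟩ : ∃ i, Valued.v (c i) = 1 := by
    by_contra hno
    push Not at hno
    apply hzp
    rw [mem_latt_iff_of_isUnit hg, Matrix.mulVec_smul, ← hcdef]
    intro l
    rw [Pi.smul_apply, smul_eq_mul, map_mul, map_inv₀]
    have hl : Valued.v (c l) ≤ Valued.v ϖ := (hlt1 _).1 (lt_of_le_of_ne (hc l) (hno l))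
    calc (Valued.v ϖ)⁻¹ * Valued.v (c l) ≤ (Valued.v ϖ)⁻¹ * Valued.v ϖ := mul_le_mul_right hl _
      _ = 1 := inv_mul_cancel₀ ((Valuation.ne_zero_iff _).2 hϖ0)
  have hci0 : c i ≠ 0 := fun h => by rw [h, map_zero] at hi; exact zero_ne_one hi
  -- `d − μ c ∈ ϖ𝒪³`, `μ = d_i ∕ c_i`
  set μ : K := d i / c i with hμ
  set r : Fin 3 → K := fun l => ϖ⁻¹ * (d l - μ * c l) with hr
  have hrint : r ∈ stdLattice K 3 := by
    intro l
    have e : d l - μ * c l = (c i * d l - c l * d i) / c i := by rw [hμ]; field_simp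
    rw [hr, map_mul, map_inv₀, e, map_div₀, hi, div_one]
    calc (Valued.v ϖ)⁻¹ * Valued.v (c i * d l - c l * d i) ≤ (Valued.v ϖ)⁻¹ * Valued.v ϖ := mul_le_mul_right ((hlt1 _).1 (hsmall i l)) _
      _ = 1 := inv_mul_cancel₀ ((Valuation.ne_zero_iff _).2 hϖ0)
  have hdec : y - μ • z = ϖ • (g : Matrix (Fin 3) (Fin 3) K).mulVec r := by
    have e : d - μ • c = ϖ • r := by
      ext l
      simp only [Pi.sub_apply, Pi.smul_apply, smul_eq_mul, hr]
      field_simp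
    rw [← Matrix.mulVec_smul, ← e, Matrix.mulVec_sub, Matrix.mulVec_smul, hgc, hgd]
  -- `1 = B₀ z y = B₀ z (y − μ z) = ϖ · B₀ z (g r)`, a contradiction
  have hgr : (g : Matrix (Fin 3) (Fin 3) K).mulVec r ∈ latt (g : Matrix (Fin 3) (Fin 3) K) := mulVec_mem_latt _ hrint
  have hv : Valued.v (B₀ σ 3 z (y - μ • z)) < 1 := by
    rw [hdec, form_smul_right, map_mul]
    calc Valued.v ϖ * Valued.v (B₀ σ 3 z ((g : Matrix (Fin 3) (Fin 3) K).mulVec r)) ≤ Valued.v ϖ * 1 :=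
          mul_le_mul_right (v_B₀_le_one_of_isSelfDualLattice hσ hvσ hL hz hgr) _
      _ < 1 := by rw [mul_one]; exact hvϖ1
  rw [map_sub, form_smul_right, hzy, hzz, mul_zero, sub_zero, map_one] at hv
  exact lt_irrefl _ hv

/-! ## §5 The head: every self-dual vertex of `(K³, J₀)` is `u·𝒪³`, `u ∈ U(σ, J₀)` -/

/-- **RANK-3 SELF-DUAL TRANSITIVITY, DATUM-FREE («htr₀-ram»).**  Let `σ` be an involution of `K` preserving the valuation, `ϖ` a uniformiser and `|2| = 1`.  Then every
self-dual vertex lattice `L` of `(K³, J₀)` is `u·𝒪³` for some `u ∈ U(σ, J₀)` — with NO unramified datum and NO condition on `σϖ` (so at a TAME RAMIFIED place, `σϖ = −ϖ`,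
as well as at a non-dyadic unramified one).  Proof: a primitive hyperbolic pair `(z, y)` in `L = latt g` (§3), a unimodular completion `(z | g_j | y)` (§4), the middle
column cleared to `x ⊥ z, y`, and the determinant class `B₀ x x = N(det)` making `(z | a⁻¹x | y)` a basis of `L` with Gram matrix EXACTLY `J₀`.
[cite: Jacobowitz1962, §4–§5 and §7–§8] [cite: Omeara1963, §93] [cite: BruhatTits1972, §10] -/
theorem exists_unitary_mapGL_stdLattice_eq_of_isSelfDualLattice_of_v_two (hσ : ∀ a, σ (σ a) = a) (hvσ : ∀ a, Valued.v (σ a) = Valued.v a)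
    (hϖ : Valued.v ϖ = WithZero.exp (-1 : ℤ)) (h2 : Valued.v (2 : K) = 1)
    {L : Submodule 𝒪[K] (Fin 3 → K)} (hL : IsSelfDualLattice σ ϖ ((StdForm.antidiagonal 3).over K) L) :
    ∃ u : unitaryGroupOfForm σ ((StdForm.antidiagonal 3).over K), L = mapGL (u : GL (Fin 3) K) (stdLattice K 3) := by
  obtain ⟨g, hLg, -, -, hGdet⟩ := id hL
  subst hLg
  have hg : IsUnit (g : Matrix (Fin 3) (Fin 3) K).det := Matrix.isUnits_det_units g
  -- `|det g| = 1` (the Gram determinant of a self-dual vertex is a unit)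
  have hvg : Valued.v (g : Matrix (Fin 3) (Fin 3) K).det = 1 := by
    rw [pow_zero, formCongr, det_gram_three, Valuation.map_neg, map_mul, hvσ] at hGdet
    exact eq_one_of_mul_self_eq_one hGdet
  -- a primitive hyperbolic pair and its unimodular completion
  obtain ⟨z, hz, y, hy, hzz, hyy, hzy, hzp⟩ := exists_hyperbolic_pair hσ hvσ hϖ h2 hL
  have hyz : B₀ σ 3 y z = 1 := by rw [← isHermitianForm_B₀ hσ z y, hzy, map_one]
  obtain ⟨j, hj⟩ := exists_v_det_completion_eq_one hσ hvσ hϖ g hL hz hy hzz hzy hzp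
  set c : Fin 3 → K := (g : Matrix (Fin 3) (Fin 3) K)⁻¹.mulVec z with hcdef
  set d : Fin 3 → K := (g : Matrix (Fin 3) (Fin 3) K)⁻¹.mulVec y with hddef
  have hc : c ∈ stdLattice K 3 := (mem_latt_iff_of_isUnit hg z).1 hz
  have hd : d ∈ stdLattice K 3 := (mem_latt_iff_of_isUnit hg y).1 hy
  have hgc : (g : Matrix (Fin 3) (Fin 3) K).mulVec c = z := by rw [hcdef, Matrix.mulVec_mulVec, Matrix.mul_nonsing_inv _ hg, Matrix.one_mulVec]
  have hgd : (g : Matrix (Fin 3) (Fin 3) K).mulVec d = y := by rw [hddef, Matrix.mulVec_mulVec, Matrix.mul_nonsing_inv _ hg, Matrix.one_mulVec]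
  -- the middle column `x = g_j − α z − β y ⊥ z, y`
  set gj : Fin 3 → K := (g : Matrix (Fin 3) (Fin 3) K).mulVec (Pi.single j 1) with hgjdef
  have hgj : gj ∈ latt (g : Matrix (Fin 3) (Fin 3) K) := mulVec_single_mem_latt _ j
  set α : K := B₀ σ 3 y gj with hαdef
  set β : K := B₀ σ 3 z gj with hβdef
  have hα : Valued.v α ≤ 1 := v_B₀_le_one_of_isSelfDualLattice hσ hvσ hL hy hgj
  have hβ : Valued.v β ≤ 1 := v_B₀_le_one_of_isSelfDualLattice hσ hvσ hL hz hgj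
  set x : Fin 3 → K := gj - α • z - β • y with hxdef
  have hzx : B₀ σ 3 z x = 0 := by
    rw [hxdef, map_sub, map_sub, form_smul_right, form_smul_right, hzz, hzy, ← hβdef]; ring
  have hyx : B₀ σ 3 y x = 0 := by
    rw [hxdef, map_sub, map_sub, form_smul_right, form_smul_right, hyz, hyy, ← hαdef]; ring
  have hxz : B₀ σ 3 x z = 0 := by rw [← isHermitianForm_B₀ hσ z x, hzx, map_zero]
  have hxy : B₀ σ 3 x y = 0 := by rw [← isHermitianForm_B₀ hσ y x, hyx, map_zero]
  -- the determinant `a = det g · det (c | e_j | d)`, a unit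
  set a : K := (g : Matrix (Fin 3) (Fin 3) K).det * (Matrix.of ![c, Pi.single j 1, d]).det with hadef
  have hva : Valued.v a = 1 := by rw [hadef, map_mul, hvg, hj, one_mul]
  have ha0 : a ≠ 0 := fun h => by rw [h, map_zero] at hva; exact zero_ne_one hva
  have hvainv : Valued.v a⁻¹ = 1 := by rw [map_inv₀, hva, inv_one]
  -- the coefficient matrix `P = (c | a⁻¹(e_j − αc − βd) | d)` ∈ GL₃(𝒪)
  set P : Matrix (Fin 3) (Fin 3) K := (Matrix.of ![c, a⁻¹ • (Pi.single j 1 - α • c - β • d), d])ᵀ with hPdef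
  have hPint : IsIntMatrix P := by
    intro i l
    rw [hPdef, Matrix.transpose_apply, Matrix.of_apply]
    fin_cases l
    · simpa using hc i
    · simp only [Fin.mk_one, Matrix.cons_val_one, Matrix.cons_val_zero, Pi.smul_apply, Pi.sub_apply, smul_eq_mul, map_mul, hvainv, one_mul]
      refine (Valuation.map_sub _ _ _).trans (max_le ((Valuation.map_sub _ _ _).trans (max_le ?_ ?_)) ?_)
      · rw [Pi.single_apply]; split_ifs <;> simp
      · rw [map_mul]; exact mul_le_one' hα (hc i)
      · rw [map_mul]; exact mul_le_one' hβ (hd i)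
    · simpa using hd i
  have hPdet : P.det = a⁻¹ * (Matrix.of ![c, Pi.single j 1, d]).det := by
    rw [hPdef, Matrix.det_transpose]
    simp only [Matrix.det_fin_three, Matrix.of_apply, Matrix.cons_val_zero, Matrix.cons_val_one, Matrix.cons_val_two, Matrix.tail_cons, Matrix.head_cons,
      Pi.smul_apply, Pi.sub_apply, smul_eq_mul]
    ring
  have hvP : Valued.v P.det = 1 := by rw [hPdet, map_mul, hvainv, hj, one_mul]
  have hP0 : P.det ≠ 0 := fun h => by rw [h, map_zero] at hvP; exact zero_ne_one hvP
  have hPinv : IsIntMatrix P⁻¹ := isIntMatrix_nonsing_inv_of_v_det_eq_one hPint hvP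
  -- the new basis `U = g P = (z | a⁻¹x | y)`
  set Pu : GL (Fin 3) K := Matrix.GeneralLinearGroup.mkOfDetNeZero P hP0 with hPu
  have hPuval : (Pu : Matrix (Fin 3) (Fin 3) K) = P := Matrix.GeneralLinearGroup.val_mkOfDetNeZero P hP0
  have hlattU : latt ((g * Pu : GL (Fin 3) K) : Matrix (Fin 3) (Fin 3) K) = latt (g : Matrix (Fin 3) (Fin 3) K) :=
    latt_mul_eq_of_isIntMatrix g Pu (by rw [hPuval]; exact hPint) (by rw [Matrix.coe_units_inv, hPuval]; exact hPinv)
  have hU0 : ((g * Pu : GL (Fin 3) K) : Matrix (Fin 3) (Fin 3) K).mulVec (Pi.single 0 1) = z := by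
    rw [Units.val_mul, hPuval, ← Matrix.mulVec_mulVec, hPdef, transpose_of_mulVec_single]; simpa using hgc
  have hU1 : ((g * Pu : GL (Fin 3) K) : Matrix (Fin 3) (Fin 3) K).mulVec (Pi.single 1 1) = a⁻¹ • x := by
    rw [Units.val_mul, hPuval, ← Matrix.mulVec_mulVec, hPdef, transpose_of_mulVec_single]
    simp only [Matrix.cons_val_one, Matrix.cons_val_zero, Matrix.mulVec_smul, Matrix.mulVec_sub, hgc, hgd, hxdef, ← hgjdef]
  have hU2 : ((g * Pu : GL (Fin 3) K) : Matrix (Fin 3) (Fin 3) K).mulVec (Pi.single 2 1) = y := by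
    rw [Units.val_mul, hPuval, ← Matrix.mulVec_mulVec, hPdef, transpose_of_mulVec_single]; simpa using hgd
  -- `det U = 1`
  have hdetU : ((g * Pu : GL (Fin 3) K) : Matrix (Fin 3) (Fin 3) K).det = 1 := by
    rw [Units.val_mul, Matrix.det_mul, hPuval, hPdet,
      show (g : Matrix (Fin 3) (Fin 3) K).det * (a⁻¹ * (Matrix.of ![c, Pi.single j 1, d]).det) = a⁻¹ * ((g : Matrix (Fin 3) (Fin 3) K).det * (Matrix.of ![c, Pi.single j 1, d]).det) by
        ring, ← hadef, inv_mul_cancel₀ ha0]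
  -- the Gram matrix of `U`: off the middle it is that of `J₀`; the middle entry `ε′ = B₀(a⁻¹x, a⁻¹x)` is forced to be `1` by the determinant
  have hxx' : B₀ σ 3 (a⁻¹ • x) z = 0 ∧ B₀ σ 3 z (a⁻¹ • x) = 0 ∧ B₀ σ 3 (a⁻¹ • x) y = 0 ∧ B₀ σ 3 y (a⁻¹ • x) = 0 := by
    refine ⟨?_, ?_, ?_, ?_⟩
    · rw [form_smul_left, hxz, mul_zero]
    · rw [form_smul_right, hzx, mul_zero]
    · rw [form_smul_left, hxy, mul_zero]
    · rw [form_smul_right, hyx, mul_zero]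
  obtain ⟨hxz', hzx', hxy', hyx'⟩ := hxx'
  have hG : formCongr σ (g * Pu) ((StdForm.antidiagonal 3).over K) = !![0, 0, 1; 0, B₀ σ 3 (a⁻¹ • x) (a⁻¹ • x), 0; 1, 0, 0] := by
    ext i l
    rw [formCongr_apply_eq_B₀]
    fin_cases i <;> fin_cases l <;> simp only [Fin.zero_eta, Fin.isValue, Fin.mk_one, Fin.reduceFinMk]
    · rw [hU0, hzz]; simp
    · rw [hU0, hU1, hzx']; simp
    · rw [hU0, hU2, hzy]; simp
    · rw [hU1, hU0, hxz']; simp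
    · rw [hU1]; simp
    · rw [hU1, hU2, hxy']; simp
    · rw [hU2, hU0, hyz]; simp
    · rw [hU2, hU1, hyx']; simp
    · rw [hU2, hyy]; simp
  have hε : B₀ σ 3 (a⁻¹ • x) (a⁻¹ • x) = 1 := by
    have h1 := det_gram_three (σ := σ) ((g * Pu : GL (Fin 3) K) : Matrix (Fin 3) (Fin 3) K)
    rw [hdetU, map_one, mul_one] at h1
    have h2 : (formCongr σ (g * Pu) ((StdForm.antidiagonal 3).over K)).det = -B₀ σ 3 (a⁻¹ • x) (a⁻¹ • x) := by
      rw [hG, Matrix.det_fin_three]; simp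
    have h3 : (formCongr σ (g * Pu) ((StdForm.antidiagonal 3).over K)).det = -1 := h1
    exact neg_inj.1 (h2.symm.trans h3)
  have hmem : (g * Pu : GL (Fin 3) K) ∈ unitaryGroupOfForm σ ((StdForm.antidiagonal 3).over K) := by
    rw [mem_unitaryGroupOfForm_iff]
    change formCongr σ (g * Pu) ((StdForm.antidiagonal 3).over K) = (StdForm.antidiagonal 3).over K
    rw [hG, hε, UnitaryGroup.antidiagonal_three_over_eq]
  refine ⟨⟨g * Pu, hmem⟩, ?_⟩
  have hrfl : mapGL ((⟨g * Pu, hmem⟩ : unitaryGroupOfForm σ ((StdForm.antidiagonal 3).over K)) : GL (Fin 3) K) (stdLattice K 3) =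
      latt ((g * Pu : GL (Fin 3) K) : Matrix (Fin 3) (Fin 3) K) := rfl
  rw [hrfl, hlattU]

/-- **Vertex form**: the root `L₀ = 𝒪³` reaches every self-dual vertex under `U(σ, J₀)` — for ANY involution `σ` preserving `v` with `|2| = 1` (twin of ★ `exists_latticeGraphIso_root_eq`
without the unramified datum; `𝒪³` is self-dual by ★ `isSelfDualLattice_stdLattice`). [cite: BruhatTits1972, §10] [cite: Tits1979, §2.4] -/
theorem exists_latticeGraphIso_root_eq_of_v_two (hσ : ∀ a, σ (σ a) = a) (hvσ : ∀ a, Valued.v (σ a) = Valued.v a)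
    (hϖ : Valued.v ϖ = WithZero.exp (-1 : ℤ)) (h2 : Valued.v (2 : K) = 1)
    (v : {M : Submodule 𝒪[K] (Fin 3 → K) // IsVertex σ ϖ ((StdForm.antidiagonal 3).over K) M}) (hv : IsSelfDualLattice σ ϖ ((StdForm.antidiagonal 3).over K) v.1)
    (h0 : IsSelfDualLattice σ ϖ ((StdForm.antidiagonal 3).over K) (stdLattice K 3)) :
    ∃ u : unitaryGroupOfForm σ ((StdForm.antidiagonal 3).over K), latticeGraphIso σ ϖ ((StdForm.antidiagonal 3).over K) u ⟨stdLattice K 3, 0, h0⟩ = v := by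
  obtain ⟨u, hu⟩ := exists_unitary_mapGL_stdLattice_eq_of_isSelfDualLattice_of_v_two hσ hvσ hϖ h2 hv
  exact ⟨u, Subtype.ext (by rw [latticeGraphIso_apply_val]; exact hu.symm)⟩

end Literature.NumberTheory.Automorphic.UnitaryLatticeTree

end
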